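import Literature.NumberTheory.LFunctions.ChebyshevPsiExplicitPartialRH
import Literature.NumberTheory.LFunctions.ZetaZeroTailSums
import Literature.NumberTheory.LFunctions.RiemannHypothesisUpTo2516
import Literature.NumberTheory.LFunctions.FordZetaZeroRecipSqSum
import Literature.NumberTheory.LFunctions.RosserSchoenfeldMertensFirstConstant
import Mathlib.NumberTheory.AbelSummation
import HarnessLib

/-!
# The Mertens remainder `E₁(x) = Σ_{n ≤ x} Λ(n)/n − log x + γ`: the identity and the two-sided
# tail bound `|E₁(x)| ≤ 1/50` for `x ≥ 442439` (stub `stub_mertensE1`)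

Crux `WeilComb.CombShapePositivity` (item stmt-RiemannHypothesis-11229), line `Sketch`, STUB-PLAN
`stub_windowCore` Phase A, helpers A1–A2 (`Cruxes/CombShapePositivity/STUB-PLAN-stub_windowCore.md`,
typed companion `SketchStubPlanWindowCore.lean`: `mertensIdentity`, `mertens_E1_abs_le`).

* `sum_vonMangoldt_div_eq_add_integral` — Abel summation:
  `Σ_{n ≤ x} Λ(n)/n = ψ(x)/x + ∫_1^x ψ(t) t⁻² dt` (`x ≥ 1`);
* `mertensIdentity` (A1) — for `x > 1`,
  `Σ_{n ≤ x} Λ(n)/n = log x − γ + (ψ(x) − x)/x − ∫_x^∞ (ψ(t) − t) t⁻² dt`,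
  from the tree's `∫_1^∞ (ψ(t) − t) t⁻² dt = −1 − γ` (`RosserSchoenfeld.integral_Ioi_psi_sub_self_div_sq`);
* `abs_mertensRemainder_le` — for `x ≥ 9`, hypothesis-free and fully explicit:
  `|E₁(x)| ≤ 0.00862 + 5.7663/√x + (1.838 + log 2π)/x + 1/(2x(x² − 1)) + 0.34·log 2516/2516`,
  assembled from the tree's `|ψ(x) − x| ≤ 0.00862x + 5.72√x + 1.838` (`PsiFromZeros2516.abs_psi_sub_self_le`,
  the 2000 certified zeros below height 2516), Rosser–Schoenfeld's Lemma 7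
  (`PsiTailIntegral.abs_integral_Ioi_psi_sub_self_div_sq_le`), `K(x)` under RH up to `2516`
  (`PsiTailIntegral.rsK_le_of_inStripUpTo riemannHypothesisInStripUpTo_2516`), Ford's
  `Σ_ρ m(ρ)/|ρ|² ≤ 0.0463` (`sum_zeroOrder_div_norm_sq_le`) and the zero-tail bound
  `Σ_{|Im ρ|>T} m(ρ)/(|ρ||ρ−1|) ≤ 2G(T) ≤ 0.34 log T/T` (`ZetaZeroTails.tailInvNormProd_le`, `Gtail_le`);
* `stub_mertensE1` (A2, registered stub) — `|E₁(x)| ≤ 1/50` for all `x ≥ 442439`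
  (numerically the bound is `0.0184`; `442439` is the end of the kernel-certified (3.22)-chain
  `MertensFirstChainRun.run2`, so that together with the chain the Mertens remainder is controlled
  for all `x ≥ 319` inside the tree, with no named fact).

Like its inputs `ChebyshevPsiExplicitPartialRH.lean` / `SchoenfeldZerosLow.lean`, everything from
`abs_mertensRemainder_le` on depends on the tree's certified Odlyzko–te Riele computation of the
first 2000 zeros (`MertensCertificate`, `native_decide`, declared computational at the gate).
-/

noncomputable section

-- the sub-problem path RiemannHypothesis/RiemannHypothesis duplicates a namespace (D-0017)
set_option linter.dupNamespace false

open MeasureTheory Set Filter ArithmeticFunction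
open scoped Chebyshev Real

namespace Summit.RiemannHypothesis.RiemannHypothesis.Theorems.WeilCombMertensE1

open Literature.NumberTheory.LFunctions

/-! ### A1: Abel summation and the Mertens identity -/

/-- **Abel summation for `Λ(n)/n`**: for real `x` (both sides vanish when `x < 2`),
`Σ_{n ≤ x} Λ(n)/n = ψ(x)/x + ∫_1^x ψ(t) t⁻² dt` (Mathlib's `sum_mul_eq_sub_integral_mul₀` with
`c = Λ`, `f(t) = 1/t`). [folklore] -/
theorem sum_vonMangoldt_div_eq_add_integral (x : ℝ) :
    ∑ n ∈ Finset.Icc 1 ⌊x⌋₊, (Λ n : ℝ) / n = ψ x / x + ∫ t in Ioc 1 x, ψ t / t ^ 2 := by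
  set c : ℕ → ℝ := fun k => (Λ k : ℝ) with hc
  set f : ℝ → ℝ := fun t => t⁻¹ with hf
  have hS : ∀ t : ℝ, ∑ k ∈ Finset.Icc 0 ⌊t⌋₊, c k = ψ t := fun t ↦ by
    rw [Chebyshev.psi_eq_sum_Icc]
  have hf_diff : ∀ t ∈ Set.Icc 1 x, DifferentiableAt ℝ f t := fun t ht =>
    (hasDerivAt_inv (show t ≠ 0 by linarith [ht.1])).differentiableAt
  have hderiv_eq : ∀ t ∈ Set.Icc 1 x, deriv f t = -(t ^ 2)⁻¹ := fun t _ => by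
    rw [hf, deriv_inv]
  have hg_cont : ContinuousOn (fun t : ℝ ↦ -(t ^ 2)⁻¹) (Set.Icc 1 x) :=
    ((continuousOn_pow 2 : ContinuousOn (fun t : ℝ ↦ t ^ 2) (Set.Icc 1 x)).inv₀
      fun t (ht : t ∈ Set.Icc 1 x) => pow_ne_zero _ (show t ≠ 0 by linarith [ht.1])).neg
  have hf_int : IntegrableOn (deriv f) (Set.Icc 1 x) :=
    hg_cont.integrableOn_Icc.congr_fun (fun t ht => (hderiv_eq t ht).symm) measurableSet_Icc
  have hc0 : c 0 = 0 := by simp [hc]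
  have habel := sum_mul_eq_sub_integral_mul₀ c hc0 x hf_diff hf_int
  have hlhs : ∑ k ∈ Finset.Icc 0 ⌊x⌋₊, f k * c k = ∑ n ∈ Finset.Icc 1 ⌊x⌋₊, (Λ n : ℝ) / n := by
    rw [Finset.Icc_eq_cons_Ioc (Nat.zero_le _), Finset.sum_cons, hc0, mul_zero, zero_add,
      show Finset.Icc 1 ⌊x⌋₊ = Finset.Ioc 0 ⌊x⌋₊ from Finset.Icc_add_one_left_eq_Ioc 0 ⌊x⌋₊]
    refine Finset.sum_congr rfl fun k _ => ?_
    rw [hf, hc, div_eq_inv_mul]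
  have hint : ∫ t in Set.Ioc 1 x, deriv f t * ∑ k ∈ Finset.Icc 0 ⌊t⌋₊, c k =
      -∫ t in Ioc 1 x, ψ t / t ^ 2 := by
    rw [← integral_neg]
    refine setIntegral_congr_fun measurableSet_Ioc fun t ht ↦ ?_
    rw [hderiv_eq t (Set.Ioc_subset_Icc_self ht), hS]
    ring
  rw [hlhs, hS, hint] at habel
  rw [habel, hf]
  simp only [div_eq_inv_mul]
  ring

/-- **A1 (the Mertens identity).** For real `x > 1`,
`Σ_{n ≤ x} Λ(n)/n = log x − γ + (ψ(x) − x)/x − ∫_x^∞ (ψ(t) − t) t⁻² dt`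
(Abel summation, `∫_1^x dt/t = log x`, and `∫_1^∞ (ψ(t) − t) t⁻² dt = −1 − γ`).
[cite: RosserSchoenfeld1962, (4.21) (the `ψ`-analogue)] -/
theorem mertensIdentity {x : ℝ} (hx : 1 < x) :
    ∑ n ∈ Finset.Icc 1 ⌊x⌋₊, (Λ n : ℝ) / n =
      Real.log x - Real.eulerMascheroniConstant + (ψ x - x) / x
        - ∫ t in Ioi x, (ψ t - t) / t ^ 2 := by
  have hx0 : 0 < x := by linarith
  rw [sum_vonMangoldt_div_eq_add_integral x]
  have hI := RosserSchoenfeld.integrableOn_psi_sub_self_div_sq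
  have hsplitIoi : ∫ t in Ioi 1, (ψ t - t) / t ^ 2 =
      (∫ t in Ioc 1 x, (ψ t - t) / t ^ 2) + ∫ t in Ioi x, (ψ t - t) / t ^ 2 := by
    rw [← setIntegral_union (Set.Ioc_disjoint_Ioi le_rfl) measurableSet_Ioi
      (hI.mono_set Ioc_subset_Ioi_self) (hI.mono_set (Ioi_subset_Ioi hx.le)),
      Ioc_union_Ioi_eq_Ioi hx.le]
  rw [RosserSchoenfeld.integral_Ioi_psi_sub_self_div_sq] at hsplitIoi
  have h1 : IntegrableOn (fun t : ℝ ↦ t⁻¹) (Ioc 1 x) := by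
    refine ((continuousOn_inv₀ (G₀ := ℝ)).mono ?_).integrableOn_Icc.mono_set Set.Ioc_subset_Icc_self
    intro t ht
    exact Set.mem_compl_singleton_iff.mpr (show (0 : ℝ) < t by linarith [ht.1]).ne'
  have hsplit : ∀ t ∈ Ioc 1 x, ψ t / t ^ 2 = (ψ t - t) / t ^ 2 + t⁻¹ := by
    intro t ht
    have ht0 : t ≠ 0 := by linarith [ht.1]
    field_simp
    ring
  rw [setIntegral_congr_fun measurableSet_Ioc hsplit,
    integral_add (hI.mono_set Ioc_subset_Ioi_self) h1]
  have hinv : ∫ t in Ioc 1 x, t⁻¹ = Real.log x := by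
    rw [← intervalIntegral.integral_of_le hx.le, integral_inv (by
      rw [Set.uIcc_of_le hx.le]; intro h0; exact absurd h0.1 (by norm_num)), div_one]
  rw [hinv]
  have : ψ x / x = (ψ x - x) / x + 1 := by field_simp; ring
  rw [this]
  linarith

/-! ### A2: the two-sided tail bound for the Mertens remainder -/

/-- `log 2516 ≤ 8` (`e⁸ > 2.718⁸ > 2516`). [folklore] -/
theorem log_2516_le : Real.log 2516 ≤ 8 := by
  rw [Real.log_le_iff_le_exp (by norm_num)]
  have h1 : (2.7182818283 : ℝ) < Real.exp 1 := Real.exp_one_gt_d9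
  have h8 : Real.exp 8 = Real.exp 1 ^ 8 := by rw [← Real.exp_nat_mul]; norm_num
  rw [h8]
  have h2 : (2516 : ℝ) ≤ (2.7182818283 : ℝ) ^ 8 := by norm_num
  exact h2.trans (pow_le_pow_left₀ (by norm_num) h1.le 8)

/-- **The explicit two-sided bound for the Mertens remainder** (hypothesis-free): for `x ≥ 9`,
`|Σ_{n ≤ x} Λ(n)/n − log x + γ| ≤ 0.00862 + 5.7663/√x + (1.838 + log 2π)/x + 1/(2x(x²−1)) + 0.34·log 2516/2516`.
The five terms: `|ψ(x) − x|/x` from the 2000 certified zeros (`0.00862 + 5.72/√x + 1.838/x`);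
Rosser–Schoenfeld's Lemma 7 for `|∫_x^∞ (ψ − t)t⁻²|` (`K(x) + log(2π)/x + 1/(2x(x²−1))`); and
`K(x) ≤ x^{−1/2} Σ_{|Im ρ| ≤ 2516} m(ρ)/|ρ|² + Σ_{|Im ρ| > 2516} m(ρ)/(|ρ||ρ−1|) ≤ 0.0463/√x + 2G(2516)`.
[cite: RosserSchoenfeld1962, Lemma 7 and (4.21)] -/
theorem abs_mertensRemainder_le {x : ℝ} (hx : 9 ≤ x) :
    |∑ n ∈ Finset.Icc 1 ⌊x⌋₊, (Λ n : ℝ) / n - Real.log x + Real.eulerMascheroniConstant| ≤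
      0.00862 + 5.7663 / Real.sqrt x + (1.838 + Real.log (2 * π)) / x
        + 1 / (2 * x * (x ^ 2 - 1)) + 0.34 * Real.log 2516 / 2516 := by
  have hx1 : 1 < x := by linarith
  have hx0 : 0 < x := by linarith
  have hsx : 0 < Real.sqrt x := Real.sqrt_pos.2 hx0
  rw [mertensIdentity hx1]
  have e : Real.log x - Real.eulerMascheroniConstant + (ψ x - x) / x
      - (∫ t in Ioi x, (ψ t - t) / t ^ 2) - Real.log x + Real.eulerMascheroniConstant =
      (ψ x - x) / x - ∫ t in Ioi x, (ψ t - t) / t ^ 2 := by ring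
  rw [e]
  -- the boundary term
  have hψ := PsiFromZeros2516.abs_psi_sub_self_le hx
  have hB : |(ψ x - x) / x| ≤ 0.00862 + 5.72 / Real.sqrt x + 1.838 / x := by
    rw [abs_div, abs_of_pos hx0, div_le_iff₀ hx0]
    have hsq : Real.sqrt x * Real.sqrt x = x := Real.mul_self_sqrt hx0.le
    have e2 : (0.00862 + 5.72 / Real.sqrt x + 1.838 / x) * x =
        0.00862 * x + 5.72 * Real.sqrt x + 1.838 := by
      field_simp
      nlinarith [hsq]
    rw [e2]
    exact hψ
  -- the tail integral
  have hInt := PsiTailIntegral.abs_integral_Ioi_psi_sub_self_div_sq_le hx1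
  have hK := PsiTailIntegral.rsK_le_of_inStripUpTo riemannHypothesisInStripUpTo_2516 hx1.le
  have htail : PsiTailIntegral.tailInvNormProd 2516 ≤ 2 * SchoenfeldBound.Gtail 2516 :=
    ZetaZeroTails.tailInvNormProd_le le_rfl
  have hG : SchoenfeldBound.Gtail 2516 ≤ 0.17 * Real.log 2516 / 2516 :=
    ZetaZeroTails.Gtail_le le_rfl
  have hSq : SchoenfeldBound.sumInvNormSq 2516 ≤ 0.0463 := sum_zeroOrder_div_norm_sq_le _
  have hrpow : x ^ (-(1 / 2 : ℝ)) = 1 / Real.sqrt x := by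
    rw [Real.sqrt_eq_rpow, Real.rpow_neg hx0.le, inv_eq_one_div]
  rw [hrpow] at hK
  have hK' : PsiTailIntegral.rsK x ≤ 0.0463 / Real.sqrt x + 0.34 * Real.log 2516 / 2516 := by
    have h1 : 1 / Real.sqrt x * SchoenfeldBound.sumInvNormSq 2516 ≤ 1 / Real.sqrt x * 0.0463 :=
      mul_le_mul_of_nonneg_left hSq (by positivity)
    have h2 : 1 / Real.sqrt x * 0.0463 = 0.0463 / Real.sqrt x := by ring
    have h3 : 2 * SchoenfeldBound.Gtail 2516 ≤ 0.34 * Real.log 2516 / 2516 := by linarith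
    linarith
  have hT : |∫ t in Ioi x, (ψ t - t) / t ^ 2| ≤
      0.0463 / Real.sqrt x + 0.34 * Real.log 2516 / 2516 + Real.log (2 * π) / x
        + 1 / (2 * x * (x ^ 2 - 1)) := by linarith
  have hsum : 5.72 / Real.sqrt x + 0.0463 / Real.sqrt x = 5.7663 / Real.sqrt x := by ring
  have hdiv : 1.838 / x + Real.log (2 * π) / x = (1.838 + Real.log (2 * π)) / x := by ring
  calc |(ψ x - x) / x - ∫ t in Ioi x, (ψ t - t) / t ^ 2|
      ≤ |(ψ x - x) / x| + |∫ t in Ioi x, (ψ t - t) / t ^ 2| := abs_sub _ _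
    _ ≤ (0.00862 + 5.72 / Real.sqrt x + 1.838 / x) +
          (0.0463 / Real.sqrt x + 0.34 * Real.log 2516 / 2516 + Real.log (2 * π) / x
            + 1 / (2 * x * (x ^ 2 - 1))) := add_le_add hB hT
    _ = 0.00862 + 5.7663 / Real.sqrt x + (1.838 + Real.log (2 * π)) / x
          + 1 / (2 * x * (x ^ 2 - 1)) + 0.34 * Real.log 2516 / 2516 := by
        rw [← hsum, ← hdiv]; ring

/-- **The Mertens remainder beyond the certified chain**: for `x ≥ 442439`,
`|Σ_{n ≤ x} Λ(n)/n − log x + γ| ≤ 0.0185` (`√x ≥ 665`, `log 2π ≤ 1.8379`, `log 2516 ≤ 8`).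
[cite: RosserSchoenfeld1962, Lemma 7 and (4.21)] -/
theorem abs_mertensRemainder_le_of_ge {x : ℝ} (hx : 442439 ≤ x) :
    |∑ n ∈ Finset.Icc 1 ⌊x⌋₊, (Λ n : ℝ) / n - Real.log x + Real.eulerMascheroniConstant| ≤
      0.0185 := by
  have h := abs_mertensRemainder_le (show (9 : ℝ) ≤ x by linarith)
  have hx0 : 0 < x := by linarith
  have hs : (665 : ℝ) ≤ Real.sqrt x := by
    rw [show (665 : ℝ) = Real.sqrt (665 ^ 2) by rw [Real.sqrt_sq (by norm_num)]]
    exact Real.sqrt_le_sqrt (by nlinarith)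
  have h1 : 5.7663 / Real.sqrt x ≤ 5.7663 / 665 := by
    apply div_le_div_of_nonneg_left (by norm_num) (by norm_num) hs
  have hl2pi := SchoenfeldMid.log_two_pi_le
  have h2 : (1.838 + Real.log (2 * π)) / x ≤ (1.838 + 1.8379) / 442439 := by
    have hnum : 0 ≤ 1.838 + Real.log (2 * π) := by
      have : 0 ≤ Real.log (2 * π) := Real.log_nonneg (by linarith [Real.pi_gt_three])
      linarith
    calc (1.838 + Real.log (2 * π)) / x ≤ (1.838 + Real.log (2 * π)) / 442439 :=
          div_le_div_of_nonneg_left hnum (by norm_num) hx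
      _ ≤ (1.838 + 1.8379) / 442439 := by
          apply div_le_div_of_nonneg_right _ (by norm_num); linarith
  have h3 : 1 / (2 * x * (x ^ 2 - 1)) ≤ 1 / (2 * 442439 * (442439 ^ 2 - 1)) := by
    apply div_le_div_of_nonneg_left (by norm_num) (by norm_num)
    have hx2 : (442439 : ℝ) ^ 2 ≤ x ^ 2 := by nlinarith
    nlinarith
  have h4 : 0.34 * Real.log 2516 / 2516 ≤ 0.34 * 8 / 2516 := by
    have := log_2516_le
    apply div_le_div_of_nonneg_right _ (by norm_num); nlinarith
  have hnum : (0.00862 : ℝ) + 5.7663 / 665 + (1.838 + 1.8379) / 442439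
      + 1 / (2 * 442439 * (442439 ^ 2 - 1)) + 0.34 * 8 / 2516 ≤ 0.0185 := by norm_num
  linarith

/-- **Stub `stub_mertensE1` (STUB-PLAN `stub_windowCore`, helper A2; registered on crux
stmt-RiemannHypothesis-11229)**: the two-sided Mertens remainder bound
`|Σ_{n ≤ x} Λ(n)/n − log x + γ| ≤ 1/50` for all real `x ≥ 442439`, hypothesis-free
(in-tree: 2000 certified zeros, RH up to height 2516, Ford's `Σ 1/|ρ|² ≤ 0.0463`,
Rosser–Schoenfeld's Lemma 7). Below `442439` the kernel-certified (3.22)-chain takes over.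
[cite: RosserSchoenfeld1962, Thm. 6 and Lemma 7] -/
theorem stub_mertensE1 : ∀ x : ℝ, 442439 ≤ x →
    |∑ n ∈ Finset.Icc 1 ⌊x⌋₊, (ArithmeticFunction.vonMangoldt n : ℝ) / n - Real.log x +
        Real.eulerMascheroniConstant| ≤ 1 / 50 := by
  intro x hx
  have := abs_mertensRemainder_le_of_ge hx
  linarith

end Summit.RiemannHypothesis.RiemannHypothesis.Theorems.WeilCombMertensE1

end
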